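import Literature.NumberTheory.EllipticCurves.CyclotomicLayerRhoTatePairingPk
import Literature.NumberTheory.EllipticCurves.CyclotomicLayerTatePairingAdic
import Literature.NumberTheory.GaloisRepresentations.ContinuousShapiroLiftCores
import Literature.NumberTheory.GaloisRepresentations.ContinuousShapiroLiftPairing
import Literature.NumberTheory.GaloisRepresentations.ContinuousShapiroOpenCoinducedDescent
import Literature.NumberTheory.EllipticCurves.Kato2004.IwasawaH1Reduction
import Literature.NumberTheory.EllipticCurves.SubgroupKummerClass
import Literature.NumberTheory.EllipticCurves.Sprung2012.ColemanMapLambdaActionProofs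
import HarnessLib

/-!
# Sketch (stub-ideation k2 g13, crux stmt-BirchSwinnertonDyer-26074, stub `stub_cmLambdaLower` = RSL_g 22608):
# (P2)_ρ — conjugation-equivariance of the PINNED ρ-layer pairing `rhoLayerPairingPk` (STUB-PLAN rev 17, Q73 / S72 LIN-X)

A PORT, line by line, of the landed W-side chain `layerLoc_conjMap` → `layerKummer_smul` → `layerPairingMod_conjMap`
(TP2 `Theorems/ThetaPartnerAtTwoSignedKatoUpToAtTwoLayerPairingModDefs.lean` §5) to the generic coefficient module `M`
(`CyclotomicLayerPairingOfFun`) and then to `T_ρ ↠ A_ρ[p^k]` with the Θ-transported Kummer classes (`CyclotomicLayerRhoTatePairingPk`).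
Everything here is PROVED (no `sorry`); nothing about BSD is claimed or proved.
-/

noncomputable section

open scoped Classical

namespace Summit.BirchSwinnertonDyer.BirchSwinnertonDyer.Cruxes.ResidualThetaCountLowerPureAtTwo.SideaK2G13

open CategoryTheory Field NumberField IsDedekindDomain _root_.WeierstrassCurve
  Literature.NumberTheory.EllipticCurves Literature.NumberTheory.EllipticCurves.CyclotomicLayer
  Literature.NumberTheory.EllipticCurves.GreenbergSelmer
  Literature.NumberTheory.GaloisRepresentations
  Literature.NumberTheory.EllipticCurves.Kobayashi2003 Literature.NumberTheory.EllipticCurves.Sprung2012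
  Literature.NumberTheory.GaloisCohomology ZpExtension

-- as in `CyclotomicLayerPairingOfFun.lean`: cup products need `LocallyCompactSpace Γ_v` (local, Prop-valued instance).
attribute [local instance] absoluteGaloisGroup_compactSpace

/-! ## §1 Generic coefficient module `M`: localisation square and invariance of the two-argument layer pairing -/

section Generic

variable {M : Type} [AddCommGroup M] [TopologicalSpace M] [DiscreteTopology M] [Finite M]
  (ρM : DiscreteGaloisModule ℚ M) (N : ℕ) [NeZero N]
  (e : M → M → AlgebraicClosure ℚ)
  (hμ : ∀ S T, e S T ^ N = 1)
  (hadd₁ : ∀ S₁ S₂ T, e (S₁ + S₂) T = e S₁ T * e S₂ T)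
  (hadd₂ : ∀ S T₁ T₂, e S (T₁ + T₂) = e S T₁ * e S T₂)
  (hgal : ∀ (σ : absoluteGaloisGroup ℚ) (S T : M), σ • e S T = e (ρM σ S) (ρM σ T))
  {p : ℕ} [Fact p.Prime] (κ : ZpExtension ℚ p) (v : HeightOneSpectrum (𝓞 ℚ))

/-- The conjugation action of `g ∈ Γ_v` on `H¹(U_n, M|)` (twin of `CyclotomicLayer.layerConj`; `conjMap` with the normality of `U_n` supplied).
[cite: SerreLocalFields1979, VII §5] -/
def layerConjOf (n : ℕ) (g : absoluteGaloisGroup (v.adicCompletion ℚ)) :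
    continuousCohomology 1 (subgroupRep (localRepOf ρM v) (layerGroup κ v n)) ⟶
      continuousCohomology 1 (subgroupRep (localRepOf ρM v) (layerGroup κ v n)) :=
  haveI := normal_layerGroup κ v n
  conjMap (localRepOf ρM v) (layerGroup κ v n) g 1

omit [Finite M] [NeZero N] in
/-- **(b)_M Localisation intertwines the conjugation actions** (port of `layerLoc_conjMap`): for `g ∈ Γ_v` with image `g̃ ∈ Γ_ℚ`,
`loc_n (g̃ · y) = g · loc_n y`. [cite: SerreLocalFields1979, VII §5] -/
theorem layerLocOf_conjMap (n : ℕ) (g : absoluteGaloisGroup (v.adicCompletion ℚ)) (y : H1 ρM (κ.layerSubgroup n)) :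
    layerLocOf ρM κ v n (conjMap ρM.toTopRep (κ.layerSubgroup n)
        (resGalOfEmb (closureEmb (K := ℚ) (v.adicCompletion ℚ)) g) 1 y) =
      layerConjOf ρM κ v n g (layerLocOf ρM κ v n y) := by
  haveI := normal_layerGroup κ v n
  obtain ⟨φ, rfl⟩ := oneCocycleClass_surjective _ y
  unfold layerLocOf layerConjOf
  rw [conjMap_oneCocycleClass, map_oneCocycleClass, map_oneCocycleClass, conjMap_oneCocycleClass]
  congr 1
  apply Subtype.ext
  ext τ
  rw [contOneCocycles.pullback_apply, TopRep.hom_ofHom, conj_pullback_apply, conj_pullback_apply,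
    contOneCocycles.pullback_apply, TopRep.hom_ofHom]
  have hab : subgroupConj (κ.layerSubgroup n) (resGalOfEmb (closureEmb (K := ℚ) (v.adicCompletion ℚ)) g)
        (resGalSubgroupOfEmb (κ.layerSubgroup n) (closureEmb (K := ℚ) (v.adicCompletion ℚ)) τ) =
      resGalSubgroupOfEmb (κ.layerSubgroup n) (closureEmb (K := ℚ) (v.adicCompletion ℚ))
        (subgroupConj (layerGroup κ v n) g τ) := by
    apply Subtype.ext
    rw [subgroupConj_apply_coe, resGalSubgroupOfEmb_apply_coe, resGalSubgroupOfEmb_apply_coe, subgroupConj_apply_coe,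
      map_mul, map_mul, map_inv]
  rw [hab]
  rfl

omit [Finite M] in
/-- **(P2)_M on `H¹ × H¹` — the two-argument layer pairing is invariant under simultaneous conjugation**:
`⟨g·x, g·y⟩_{n,N} = ⟨x, y⟩_{n,N}`.  Shapiro turns conjugation by `g` into right translation by `gU_n` (`shapiroLift_conjMap`), the summed
pairing is invariant under right translation (`ContPairing.cupProduct_rTransHom`). [cite: NeukirchSchmidtWingberg2008, I §5 Prop. (1.5.3)]
[cite: SerreLocalFields1979, VII §5] -/
theorem layerPairingH1Of_conjMap (n : ℕ) (g : absoluteGaloisGroup (v.adicCompletion ℚ))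
    (x y : continuousCohomology 1 (subgroupRep (localRepOf ρM v) (layerGroup κ v n))) :
    layerPairingH1Of ρM N e hμ hadd₁ hadd₂ hgal κ v n (layerConjOf ρM κ v n g x) (layerConjOf ρM κ v n g y) =
      layerPairingH1Of ρM N e hμ hadd₁ hadd₂ hgal κ v n x y := by
  haveI := normal_layerGroup κ v n
  letI : Fintype (absoluteGaloisGroup (v.adicCompletion ℚ) ⧸ layerGroup κ v n) := layerFintypeQuot κ v n
  rw [layerPairingH1Of_apply, layerPairingH1Of_apply]
  unfold layerShapiroOf layerSumPairingOf layerConjOf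
  rw [shapiroLift_conjMap, shapiroLift_conjMap, ContPairing.cupProduct_rTransHom, cohomologyMap_id_apply]

omit [Finite M] in
/-- **(P2)_M for the pairing with a global first argument**: `⟨g̃·x, g·y⟩ = ⟨x, y⟩` (`layerPairingOf = layerPairingH1Of ∘ loc_n`).
[cite: SerreLocalFields1979, VII §5] -/
theorem layerPairingOf_conjMap (n : ℕ) (g : absoluteGaloisGroup (v.adicCompletion ℚ)) (x : H1 ρM (κ.layerSubgroup n))
    (y : continuousCohomology 1 (subgroupRep (localRepOf ρM v) (layerGroup κ v n))) :
    layerPairingOf ρM N e hμ hadd₁ hadd₂ hgal κ v n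
        (conjMap ρM.toTopRep (κ.layerSubgroup n) (resGalOfEmb (closureEmb (K := ℚ) (v.adicCompletion ℚ)) g) 1 x)
        (layerConjOf ρM κ v n g y) =
      layerPairingOf ρM N e hμ hadd₁ hadd₂ hgal κ v n x y := by
  rw [layerPairingOf_apply, layerPairingOf_apply, layerLocOf_conjMap, layerPairingH1Of_conjMap]

end Generic

/-! ## §2 The curve side in the Literature dialect: `κ_{U_n}(g • Q) = g · κ_{U_n}(Q)` for `CyclotomicLayer.layerKummer` -/

section Curve

variable (W : WeierstrassCurve ℚ) [W.IsElliptic] (N : ℕ) [NeZero N] {p : ℕ} [Fact p.Prime] (κ : ZpExtension ℚ p)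
  (v : HeightOneSpectrum (𝓞 ℚ))

attribute [local instance] finite_geomTorsion_of_neZero

/-- **The (Literature) layer Kummer map is `Γ_v`-equivariant** — port of TP2 `layerKummer_smul` to `CyclotomicLayer.layerKummer`
(`conjMap_subgroupKummerClass`). [cite: Kobayashi2003, (8.23) (p. 18)] -/
theorem layerKummer_smul (n : ℕ) (g : absoluteGaloisGroup (v.adicCompletion ℚ)) (Q : localPoints W (v.adicCompletion ℚ))
    (hQ : Q ∈ localLayerPointsOfEmb κ (closureEmb (K := ℚ) (v.adicCompletion ℚ)) W n) :
    CyclotomicLayer.layerKummer W N κ v n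
        ⟨g • Q, smul_mem_localLayerPointsOfEmb κ (closureEmb (K := ℚ) (v.adicCompletion ℚ)) W n g hQ⟩ =
      layerConj W N κ v n g (CyclotomicLayer.layerKummer W N κ v n ⟨Q, hQ⟩) := by
  haveI := normal_layerGroup κ v n
  have hN : (N : ℤ) ≠ 0 := by exact_mod_cast (NeZero.ne N)
  have hroot : (N : ℤ) • W.subgroupZSMulRoot (N : ℤ) hN Q = Q := W.zsmul_subgroupZSMulRoot (N : ℤ) hN Q
  have hfix : (N : ℤ) • W.subgroupZSMulRoot (N : ℤ) hN Q ∈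
      FixedPoints.addSubgroup (layerGroup κ v n) (localPoints W (v.adicCompletion ℚ)) := by
    rw [hroot]; exact hQ
  have hgroot : (N : ℤ) • (g • W.subgroupZSMulRoot (N : ℤ) hN Q) = g • Q := by
    rw [← smul_zsmul_localPoints, hroot]
  have hgfix : (N : ℤ) • (g • W.subgroupZSMulRoot (N : ℤ) hN Q) ∈
      FixedPoints.addSubgroup (layerGroup κ v n) (localPoints W (v.adicCompletion ℚ)) := by
    rw [hgroot]; exact smul_mem_localLayerPointsOfEmb κ (closureEmb (K := ℚ) (v.adicCompletion ℚ)) W n g hQ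
  unfold layerConj CyclotomicLayer.layerKummer
  change W.subgroupKummerMap (N : ℤ) (layerGroup κ v n) hN
      (⟨g • Q, smul_mem_localLayerPointsOfEmb κ (closureEmb (K := ℚ) (v.adicCompletion ℚ)) W n g hQ⟩ :
        FixedPoints.addSubgroup (layerGroup κ v n) (localPoints W (v.adicCompletion ℚ))) =
    conjMap (torsionLocalRep W N v) (layerGroup κ v n) g 1 (W.subgroupKummerMap (N : ℤ) (layerGroup κ v n) hN
      (⟨Q, hQ⟩ : FixedPoints.addSubgroup (layerGroup κ v n) (localPoints W (v.adicCompletion ℚ))))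
  rw [W.subgroupKummerMap_apply_eq (N : ℤ) (layerGroup κ v n) hN _ _ hgfix hgroot,
    W.subgroupKummerMap_apply_eq (N : ℤ) (layerGroup κ v n) hN _ _ hfix hroot,
    W.conjMap_subgroupKummerClass (N : ℤ) (layerGroup κ v n) hN g _ hfix hgfix]

end Curve

/-! ## §3 `ρ`-coefficients: reduction, Θ-transport, and (P2)_ρ for `rhoLayerPairingPk` -/

section Rho

variable {p : ℕ} [Fact p.Prime] (S : Set (PadicAlgCl p)) {d : ℕ} (ρ : FramedGaloisRep ℚ (padicCoeffIntegers S) d)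
  (W : WeierstrassCurve ℚ) [W.IsElliptic] {r : ℕ}
  (ePk : ∀ k : ℕ, ↥(AddSubgroup.torsionBy (Cofree ρ (padicCoeffField S)) ((p ^ k : ℕ) : ℤ)) →
    ↥(AddSubgroup.torsionBy (Cofree ρ (padicCoeffField S)) ((p ^ k : ℕ) : ℤ)) → AlgebraicClosure ℚ)
  (hμPk : ∀ k a b, ePk k a b ^ (p ^ k) = 1)
  (hadd₁Pk : ∀ k a₁ a₂ b, ePk k (a₁ + a₂) b = ePk k a₁ b * ePk k a₂ b)
  (hadd₂Pk : ∀ k a b₁ b₂, ePk k a (b₁ + b₂) = ePk k a b₁ * ePk k a b₂)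
  (hgalPk : ∀ k (σ : absoluteGaloisGroup ℚ) (a b : ↥(AddSubgroup.torsionBy (Cofree ρ (padicCoeffField S)) ((p ^ k : ℕ) : ℤ))),
    σ • ePk k a b = ePk k (cofreeTorsionGaloisModule S ρ _ σ a) (cofreeTorsionGaloisModule S ρ _ σ b))
  (Θ : Cofree ρ (padicCoeffField S) ≃+ (Fin r → W.geomPrimaryTorsion p)) (κ : ZpExtension ℚ p)
  (v : HeightOneSpectrum (𝓞 ℚ))
  (hΘ : ∀ (δ : absoluteGaloisGroup (v.adicCompletion ℚ)) (m : Cofree ρ (padicCoeffField S)) (i : Fin r),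
    Θ (resGalOfEmb (closureEmb (K := ℚ) (v.adicCompletion ℚ)) δ • m) i =
      resGalOfEmb (closureEmb (K := ℚ) (v.adicCompletion ℚ)) δ • Θ m i)

attribute [local instance] finite_geomTorsion_of_neZero

/-- **(a)_ρ The reduction `red_{p^k} : H¹(U, T_ρ) → H¹(U, A_ρ[p^k])` commutes with conjugation** by `γ ∈ Γ_ℚ` (`U` normal):
`mapH1AddHom_conjMap` for the `Γ_ℚ`-equivariant continuous map `divPowCofreeMkTorsion`. [cite: Kato2004Asterisque, §13.8 (p. 228)]
[cite: NeukirchSchmidtWingberg2008, I §5] -/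
theorem reduceH1CofreePkTorsion_conjMap (k : ℕ) (U : Subgroup (absoluteGaloisGroup ℚ)) [U.Normal] (γ : absoluteGaloisGroup ℚ)
    (x : H1 (FramedGaloisRep.toGaloisRep ρ) U) :
    reduceH1CofreePkTorsion S ρ k U (conjMap (FramedGaloisRep.toGaloisRep ρ).toTopRep U γ 1 x) =
      conjMap (cofreeTorsionGaloisModule S ρ ((p ^ k : ℕ) : ℤ)).toTopRep U γ 1 (reduceH1CofreePkTorsion S ρ k U x) :=
  mapH1AddHom_conjMap (X := (FramedGaloisRep.toGaloisRep ρ).toTopRep)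
    (Y := (cofreeTorsionGaloisModule S ρ ((p ^ k : ℕ) : ℤ)).toTopRep) (divPowCofreeMkTorsion S ρ k)
    (continuous_divPowCofreeMkTorsion S ρ k) (fun γ t ↦ Subtype.ext (divPowCofreeMk_smul S ρ k γ t)) γ
    (divPowCofreeMkTorsion_subgroupRep S ρ k U) x

omit [W.IsElliptic] in
/-- **(f₁)_ρ `(thetaSingle i)_*` commutes with conjugation** by `g ∈ Γ_v`: `Θ⁻¹(·δ_i)` is `Γ_v`-equivariant (`thetaSingle_smul`, from `hΘ`),
so `mapH1AddHom_conjMap` applies. [cite: Greenberg1989, §1 p. 98] [cite: SerreLocalFields1979, VII §5] -/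
theorem thetaSingleH1_conjMap (k : ℕ) (i : Fin r) (n : ℕ) (g : absoluteGaloisGroup (v.adicCompletion ℚ))
    (c : continuousCohomology 1 (subgroupRep (torsionLocalRep W (p ^ k) v) (layerGroup κ v n))) :
    thetaSingleH1 S ρ k W Θ κ v hΘ i n (layerConj W (p ^ k) κ v n g c) =
      layerConjOf (cofreeTorsionGaloisModule S ρ ((p ^ k : ℕ) : ℤ)) κ v n g (thetaSingleH1 S ρ k W Θ κ v hΘ i n c) := by
  haveI := normal_layerGroup κ v n
  unfold thetaSingleH1 layerConj layerConjOf
  exact mapH1AddHom_conjMap (X := torsionLocalRep W (p ^ k) v) (Y := cofreeTorsionLocalRep S ρ ((p ^ k : ℕ) : ℤ) v)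
    (thetaSingle ρ p k W Θ i) continuous_of_discreteTopology (fun δ P ↦ thetaSingle_smul ρ p k W Θ v hΘ i δ P) g
    (thetaSingle_subgroupRep S ρ k W Θ κ v hΘ i n) c

/-- `g • Q` on a tuple of layer points (`E(ℚ_{n,v})` is `Γ_v`-stable: `smul_mem_localLayerPointsOfEmb`). [cite: Kobayashi2003, §2 (p. 4)] -/
def conjTuple (n : ℕ) (g : absoluteGaloisGroup (v.adicCompletion ℚ))
    (Q : Fin r → localLayerPointsOfEmb κ (closureEmb (K := ℚ) (v.adicCompletion ℚ)) W n) :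
    Fin r → localLayerPointsOfEmb κ (closureEmb (K := ℚ) (v.adicCompletion ℚ)) W n :=
  fun i ↦ ⟨g • (Q i : localPoints W (v.adicCompletion ℚ)),
    smul_mem_localLayerPointsOfEmb κ (closureEmb (K := ℚ) (v.adicCompletion ℚ)) W n g (Q i).2⟩

omit [W.IsElliptic] in
/-- `g • (g⁻¹ • Q) = Q` on tuples of layer points. [cite: Kobayashi2003, §2 (p. 4)] -/
theorem conjTuple_conjTuple_inv (n : ℕ) (g : absoluteGaloisGroup (v.adicCompletion ℚ))
    (Q : Fin r → localLayerPointsOfEmb κ (closureEmb (K := ℚ) (v.adicCompletion ℚ)) W n) :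
    conjTuple W κ v n g (conjTuple W κ v n g⁻¹ Q) = Q := by
  funext i
  apply Subtype.ext
  show g • g⁻¹ • (Q i : localPoints W (v.adicCompletion ℚ)) = Q i
  rw [smul_inv_smul]

/-- **(f)_ρ The Θ-transported Kummer map is `Γ_v`-equivariant**: `thetaLayerKummer (g • Q) = g · thetaLayerKummer Q`
(`thetaLayerKummer Q = Σ_i (thetaSingle i)_* κ_{U_n}(Q_i)`, `layerKummer_smul`, `thetaSingleH1_conjMap`). [cite: Kobayashi2003, (8.23) (p. 18)] -/
theorem thetaLayerKummer_conjTuple (k n : ℕ) (g : absoluteGaloisGroup (v.adicCompletion ℚ))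
    (Q : Fin r → localLayerPointsOfEmb κ (closureEmb (K := ℚ) (v.adicCompletion ℚ)) W n) :
    thetaLayerKummer S ρ k W Θ κ v hΘ n (conjTuple W κ v n g Q) =
      layerConjOf (cofreeTorsionGaloisModule S ρ ((p ^ k : ℕ) : ℤ)) κ v n g (thetaLayerKummer S ρ k W Θ κ v hΘ n Q) := by
  rw [thetaLayerKummer_apply, thetaLayerKummer_apply, map_sum]
  refine Finset.sum_congr rfl fun i _ ↦ ?_
  rw [← thetaSingleH1_conjMap, ← layerKummer_smul W (p ^ k) κ v n g (Q i : localPoints W (v.adicCompletion ℚ)) (Q i).2]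
  rfl

/-- **(P2)_ρ — Galois invariance of the pinned `ρ`-layer pairing**: for `g ∈ Γ_v` with image `g̃ ∈ Γ_ℚ`, `x ∈ H¹(Γ_n, T_ρ)`, `Q ∈ E(ℚ_{n,v})^r`,
`⟨g̃ · x, g • Q⟩_{n,p^k} = ⟨x, Q⟩_{n,p^k}`.  Assembly exactly as the W-side `layerPairingMod_conjMap`: reduction, localisation and the
Θ-Kummer map are equivariant ((a) (b) (f)), and the two-argument pairing is invariant (`layerPairingH1Of_conjMap`).
[cite: Kato2004Asterisque, §14.9 (p. 239)] [cite: PerrinRiou1994Invent, §3.6.1] [cite: SerreLocalFields1979, VII §5] -/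
theorem rhoLayerPairingPk_conjMap (n k : ℕ) (g : absoluteGaloisGroup (v.adicCompletion ℚ))
    (x : H1 (FramedGaloisRep.toGaloisRep ρ) (κ.layerSubgroup n))
    (Q : Fin r → localLayerPointsOfEmb κ (closureEmb (K := ℚ) (v.adicCompletion ℚ)) W n) :
    rhoLayerPairingPk S ρ W ePk hμPk hadd₁Pk hadd₂Pk hgalPk Θ κ v hΘ n k
        (conjMap (FramedGaloisRep.toGaloisRep ρ).toTopRep (κ.layerSubgroup n)
          (resGalOfEmb (closureEmb (K := ℚ) (v.adicCompletion ℚ)) g) 1 x) (conjTuple W κ v n g Q) =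
      rhoLayerPairingPk S ρ W ePk hμPk hadd₁Pk hadd₂Pk hgalPk Θ κ v hΘ n k x Q := by
  have h1 := reduceH1CofreePkTorsion_conjMap S ρ k (κ.layerSubgroup n) (resGalOfEmb (closureEmb (K := ℚ) (v.adicCompletion ℚ)) g) x
  have h2 := layerLocOf_conjMap (cofreeTorsionGaloisModule S ρ ((p ^ k : ℕ) : ℤ)) κ v n g
    (reduceH1CofreePkTorsion S ρ k (κ.layerSubgroup n) x)
  have h3 := thetaLayerKummer_conjTuple S ρ W Θ κ v hΘ k n g Q
  rw [rhoLayerPairingPk_apply, rhoLayerPairingPk_apply]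
  rw [h1]
  rw [h2]
  exact (congrArg _ h3).trans (layerPairingH1Of_conjMap (cofreeTorsionGaloisModule S ρ ((p ^ k : ℕ) : ℤ)) (p ^ k) (ePk k) (hμPk k)
    (hadd₁Pk k) (hadd₂Pk k) (hgalPk k) κ v n g _ _)

/-- **(P2)_ρ in the form consumed downstream (Q73)**: conjugating the class moves `g⁻¹` onto the points,
`⟨g̃ · x, Q⟩_{n,p^k} = ⟨x, g⁻¹ • Q⟩_{n,p^k}`. [cite: PerrinRiou1994Invent, §3.6.1] -/
theorem rhoLayerPairingPk_conjMap_left (n k : ℕ) (g : absoluteGaloisGroup (v.adicCompletion ℚ))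
    (x : H1 (FramedGaloisRep.toGaloisRep ρ) (κ.layerSubgroup n))
    (Q : Fin r → localLayerPointsOfEmb κ (closureEmb (K := ℚ) (v.adicCompletion ℚ)) W n) :
    rhoLayerPairingPk S ρ W ePk hμPk hadd₁Pk hadd₂Pk hgalPk Θ κ v hΘ n k
        (conjMap (FramedGaloisRep.toGaloisRep ρ).toTopRep (κ.layerSubgroup n)
          (resGalOfEmb (closureEmb (K := ℚ) (v.adicCompletion ℚ)) g) 1 x) Q =
      rhoLayerPairingPk S ρ W ePk hμPk hadd₁Pk hadd₂Pk hgalPk Θ κ v hΘ n k x (conjTuple W κ v n g⁻¹ Q) := by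
  conv_lhs => rw [← conjTuple_conjTuple_inv W κ v n g Q]
  rw [rhoLayerPairingPk_conjMap]

/-! ## §4 The `ℤ_p`-valued pairing (K-c `rhoLayerPairingAdic`): (P2)_ρ passes to the limit residue-wise -/

/-- **(P2)_ρ for the `ℤ_p`-valued layer pairing** `rhoLayerPairingAdic` (its residues are the `rhoLayerPairingPk`, and `ℤ_p` is
`p`-adically separated: `rhoLayerPairingAdic_apply_eq_of_forall`). [cite: PerrinRiou1994Invent, §3.6.1] -/
theorem rhoLayerPairingAdic_conjMap (n : ℕ)
    (hcompat : ∀ (k : ℕ) (x : H1 (FramedGaloisRep.toGaloisRep ρ) (κ.layerSubgroup n))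
      (Q : Fin r → localLayerPointsOfEmb κ (closureEmb (K := ℚ) (v.adicCompletion ℚ)) W n),
      (ZMod.cast (rhoLayerPairingPk S ρ W ePk hμPk hadd₁Pk hadd₂Pk hgalPk Θ κ v hΘ n (k + 1) x Q) : ZMod (p ^ k)) =
        rhoLayerPairingPk S ρ W ePk hμPk hadd₁Pk hadd₂Pk hgalPk Θ κ v hΘ n k x Q)
    (g : absoluteGaloisGroup (v.adicCompletion ℚ)) (x : H1 (FramedGaloisRep.toGaloisRep ρ) (κ.layerSubgroup n))
    (Q : Fin r → localLayerPointsOfEmb κ (closureEmb (K := ℚ) (v.adicCompletion ℚ)) W n) :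
    rhoLayerPairingAdic S ρ W ePk hμPk hadd₁Pk hadd₂Pk hgalPk Θ κ v hΘ n hcompat
        (conjMap (FramedGaloisRep.toGaloisRep ρ).toTopRep (κ.layerSubgroup n)
          (resGalOfEmb (closureEmb (K := ℚ) (v.adicCompletion ℚ)) g) 1 x) (conjTuple W κ v n g Q) =
      rhoLayerPairingAdic S ρ W ePk hμPk hadd₁Pk hadd₂Pk hgalPk Θ κ v hΘ n hcompat x Q :=
  rhoLayerPairingAdic_apply_eq_of_forall S ρ W ePk hμPk hadd₁Pk hadd₂Pk hgalPk Θ κ v hΘ n hcompat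
    (fun k ↦ rhoLayerPairingPk_conjMap S ρ W ePk hμPk hadd₁Pk hadd₂Pk hgalPk Θ κ v hΘ n k g x Q)

/-- **(P2)_ρ, `ℤ_p`-valued, left form**: `⟨g̃ · x, Q⟩_n = ⟨x, g⁻¹ • Q⟩_n` in `ℤ_p`. [cite: PerrinRiou1994Invent, §3.6.1] -/
theorem rhoLayerPairingAdic_conjMap_left (n : ℕ)
    (hcompat : ∀ (k : ℕ) (x : H1 (FramedGaloisRep.toGaloisRep ρ) (κ.layerSubgroup n))
      (Q : Fin r → localLayerPointsOfEmb κ (closureEmb (K := ℚ) (v.adicCompletion ℚ)) W n),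
      (ZMod.cast (rhoLayerPairingPk S ρ W ePk hμPk hadd₁Pk hadd₂Pk hgalPk Θ κ v hΘ n (k + 1) x Q) : ZMod (p ^ k)) =
        rhoLayerPairingPk S ρ W ePk hμPk hadd₁Pk hadd₂Pk hgalPk Θ κ v hΘ n k x Q)
    (g : absoluteGaloisGroup (v.adicCompletion ℚ)) (x : H1 (FramedGaloisRep.toGaloisRep ρ) (κ.layerSubgroup n))
    (Q : Fin r → localLayerPointsOfEmb κ (closureEmb (K := ℚ) (v.adicCompletion ℚ)) W n) :
    rhoLayerPairingAdic S ρ W ePk hμPk hadd₁Pk hadd₂Pk hgalPk Θ κ v hΘ n hcompat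
        (conjMap (FramedGaloisRep.toGaloisRep ρ).toTopRep (κ.layerSubgroup n)
          (resGalOfEmb (closureEmb (K := ℚ) (v.adicCompletion ℚ)) g) 1 x) Q =
      rhoLayerPairingAdic S ρ W ePk hμPk hadd₁Pk hadd₂Pk hgalPk Θ κ v hΘ n hcompat x (conjTuple W κ v n g⁻¹ Q) :=
  rhoLayerPairingAdic_apply_eq_of_forall S ρ W ePk hμPk hadd₁Pk hadd₂Pk hgalPk Θ κ v hΘ n hcompat
    (fun k ↦ rhoLayerPairingPk_conjMap_left S ρ W ePk hμPk hadd₁Pk hadd₂Pk hgalPk Θ κ v hΘ n k g x Q)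

end Rho

/-! ## §5 κ-alignment for ANY coefficient object (generic twin of W-side `ColGlue.conjMap_eq_conjMap_resGalOfEmb`) -/

section Align

variable {p : ℕ} [Fact p.Prime] {R : Type} [CommRing R] [TopologicalSpace R] (X : TopRep.{0} R (absoluteGaloisGroup ℚ))
  {κ : ZpExtension ℚ p} {γ : absoluteGaloisGroup ℚ} (v : HeightOneSpectrum (𝓞 ℚ)) {g : absoluteGaloisGroup (v.adicCompletion ℚ)}

/-- **`conj_γ = conj_{res g}` on `H¹(Γ_n, X)` for every topological coefficient module `X`** when `κ γ = 1 = κ (res g)` (both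
topological generators): they differ by an element of `Gal(ℚ̄/ℚ_∞) ≤ Γ_n`, which acts trivially (inner automorphisms). The W-side
`ColGlue.conjMap_eq_conjMap_resGalOfEmb` is the case `X = T_pW`; the LIN-X step of S2 needs `X = T_ρ`. [cite: SerreLocalFields1979, VII §5 Prop. 3] -/
theorem conjMap_eq_conjMap_resGalOfEmb_of (hγ : κ.IsTopGenerator γ)
    (hg : κ.IsTopGenerator (resGalOfEmb (closureEmb (K := ℚ) (v.adicCompletion ℚ)) g)) (n : ℕ)
    (y : continuousCohomology 1 (subgroupRep X (κ.layerSubgroup n))) :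
    conjMap X (κ.layerSubgroup n) γ 1 y =
      conjMap X (κ.layerSubgroup n) (resGalOfEmb (closureEmb (K := ℚ) (v.adicCompletion ℚ)) g) 1 y := by
  have hmem : (resGalOfEmb (closureEmb (K := ℚ) (v.adicCompletion ℚ)) g)⁻¹ * γ ∈ κ.layerSubgroup n := by
    refine κ.kerSubgroup_le_layerSubgroup n ?_
    rw [mem_kerSubgroup, map_mul, map_inv]
    change (κ (resGalOfEmb (closureEmb (K := ℚ) (v.adicCompletion ℚ)) g))⁻¹ * κ γ = 1
    rw [show κ (resGalOfEmb (closureEmb (K := ℚ) (v.adicCompletion ℚ)) g) = Multiplicative.ofAdd 1 from hg,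
      show κ γ = Multiplicative.ofAdd 1 from hγ, inv_mul_cancel]
  have h1 : γ = resGalOfEmb (closureEmb (K := ℚ) (v.adicCompletion ℚ)) g * ((resGalOfEmb (closureEmb (K := ℚ) (v.adicCompletion ℚ)) g)⁻¹ * γ) := (mul_inv_cancel_left _ _).symm
  have h2 := conjMap_conjMap X (κ.layerSubgroup n) ((resGalOfEmb (closureEmb (K := ℚ) (v.adicCompletion ℚ)) g)⁻¹ * γ) (resGalOfEmb (closureEmb (K := ℚ) (v.adicCompletion ℚ)) g) 1 y
  rw [conjMap_eq_self_of_mem_one _ _ hmem y, ← h1] at h2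
  exact h2.symm

end Align

end Summit.BirchSwinnertonDyer.BirchSwinnertonDyer.Cruxes.ResidualThetaCountLowerPureAtTwo.SideaK2G13

end
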